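import Mathlib

/-!
# Crux `MonotoneSuffices` (stmt-PneNP-18026), the ROOM theorem — part 4a:
# the base asymptotics of the planted-clique size `k = ⌈n^{1/2-δ}⌉`

Elementary eventual inequalities in `n` relating `k(n) = ⌈n^{1/2-δ}⌉`, `L(n) = ⌊log₂ n⌋` and `log₂ n`
(`0 < δ < 1/2`, `ε > 0`), consumed by the parameter bookkeeping of the guess-and-verify detector (part 4b):

* `eventually_kBig`   — `3200 (L+1)² + 20 ≤ k`            (`log² n = o(n^{1/2-δ})`);
* `eventually_sixK`   — `6 k ≤ n`;
* `kSq_le_four_mul`   — `k² ≤ 4 n`;         `rpow_le_kSq` — `n^{1-2δ} ≤ k²`;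
* `eventually_logSlack` — `18 + 2 log₂ (L+1) ≤ ε log₂ n`  (`log log n = o(log n)`);
* `eventually_base`   — all of the above together with `2048 ≤ n`.

Real analysis only (Mathlib's `isLittleO_log_rpow_atTop`, `isLittleO_log_id_atTop`, `tendsto_logb_atTop`).
-/

set_option linter.dupNamespace false -- `Summit.PneNP.PneNP.…`: summit = sub-problem name (D-0017 single-conjunct layout)

namespace Summit.PneNP.PneNP.Theorems.MonotoneSuffices.Room

open Filter Real Finset Asymptotics

/-! ### `log₂ n` -/

/-- `1 ≤ log₂ n` for `n ≥ 2`. [folklore] -/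
theorem one_le_logb {n : ℕ} (hn : 2 ≤ n) : (1 : ℝ) ≤ Real.logb 2 n := by
  have hnpos : (0 : ℝ) < n := by exact_mod_cast (show 0 < n by omega)
  rw [Real.le_logb_iff_rpow_le (by norm_num) hnpos, Real.rpow_one]
  exact_mod_cast hn

/-! ### The size of the planted clique -/

/-- `n^{1/2-δ} ≤ k = ⌈n^{1/2-δ}⌉ < n^{1/2-δ} + 1`. [folklore] -/
theorem rpow_le_k (δ : ℝ) (n : ℕ) : (n : ℝ) ^ (1 / 2 - δ) ≤ (⌈(n : ℝ) ^ (1 / 2 - δ)⌉₊ : ℝ) :=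
  Nat.le_ceil _

/-- `k < n^{1/2-δ} + 1`. [folklore] -/
theorem k_lt_rpow_add_one (δ : ℝ) (n : ℕ) : (⌈(n : ℝ) ^ (1 / 2 - δ)⌉₊ : ℝ) < (n : ℝ) ^ (1 / 2 - δ) + 1 :=
  Nat.ceil_lt_add_one (Real.rpow_nonneg (Nat.cast_nonneg n) _)

/-- `k ≤ √n + 1` (as `n^{1/2} + 1`) for `0 < δ`, `n ≥ 1`. [folklore] -/
theorem k_le_sqrt_add_one {δ : ℝ} (hδ : 0 < δ) {n : ℕ} (hn : 1 ≤ n) :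
    (⌈(n : ℝ) ^ (1 / 2 - δ)⌉₊ : ℝ) ≤ (n : ℝ) ^ (1 / 2 : ℝ) + 1 := by
  have hn1 : (1 : ℝ) ≤ n := by exact_mod_cast hn
  have h1 : (n : ℝ) ^ (1 / 2 - δ) ≤ (n : ℝ) ^ (1 / 2 : ℝ) :=
    Real.rpow_le_rpow_of_exponent_le hn1 (by linarith)
  linarith [k_lt_rpow_add_one δ n]

/-- `(n^{1/2})² = n`. [folklore] -/
theorem rpow_half_sq (n : ℕ) : ((n : ℝ) ^ (1 / 2 : ℝ)) ^ 2 = n := by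
  rw [← Real.rpow_mul_natCast (Nat.cast_nonneg n)]
  norm_num

/-- **`k² ≤ 4n`** for `0 < δ`. [folklore] -/
theorem kSq_le_four_mul {δ : ℝ} (hδ : 0 < δ) {n : ℕ} (hn : 1 ≤ n) : ⌈(n : ℝ) ^ (1 / 2 - δ)⌉₊ ^ 2 ≤ 4 * n := by
  have hk := k_le_sqrt_add_one hδ hn
  have hs1 : (1 : ℝ) ≤ (n : ℝ) ^ (1 / 2 : ℝ) := Real.one_le_rpow (by exact_mod_cast hn) (by norm_num)
  have hsq := rpow_half_sq n
  have h : ((⌈(n : ℝ) ^ (1 / 2 - δ)⌉₊ ^ 2 : ℕ) : ℝ) ≤ ((4 * n : ℕ) : ℝ) := by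
    push_cast
    nlinarith [Nat.cast_nonneg (α := ℝ) ⌈(n : ℝ) ^ (1 / 2 - δ)⌉₊]
  exact_mod_cast h

/-- **`n^{1-2δ} ≤ k²`.** [folklore] -/
theorem rpow_le_kSq (δ : ℝ) (n : ℕ) : (n : ℝ) ^ (1 - 2 * δ) ≤ (⌈(n : ℝ) ^ (1 / 2 - δ)⌉₊ : ℝ) ^ 2 := by
  have hsq : ((n : ℝ) ^ (1 / 2 - δ)) ^ 2 = (n : ℝ) ^ (1 - 2 * δ) := by
    rw [← Real.rpow_mul_natCast (Nat.cast_nonneg n)]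
    norm_num
    ring_nf
  rw [← hsq]
  exact pow_le_pow_left₀ (Real.rpow_nonneg (Nat.cast_nonneg n) _) (rpow_le_k δ n) 2

/-- **`k ≤ n`** for `n ≥ 1`. [folklore] -/
theorem k_le_self {δ : ℝ} (hδ : 0 < δ) {n : ℕ} (hn : 1 ≤ n) : ⌈(n : ℝ) ^ (1 / 2 - δ)⌉₊ ≤ n := by
  refine Nat.ceil_le.2 ?_
  have hn1 : (1 : ℝ) ≤ n := by exact_mod_cast hn
  calc (n : ℝ) ^ (1 / 2 - δ) ≤ (n : ℝ) ^ (1 : ℝ) := Real.rpow_le_rpow_of_exponent_le hn1 (by linarith)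
    _ = n := Real.rpow_one _

/-- **Eventually `6 k ≤ n`.** [folklore] -/
theorem eventually_sixK {δ : ℝ} (hδ : 0 < δ) : ∀ᶠ n : ℕ in atTop, 6 * ⌈(n : ℝ) ^ (1 / 2 - δ)⌉₊ ≤ n := by
  filter_upwards [eventually_ge_atTop 144] with n hn
  have hn1 : 1 ≤ n := by omega
  have hk := k_le_sqrt_add_one hδ hn1
  have hsq := rpow_half_sq n
  -- `n^{1/2} ≥ 12`
  have hs12 : (12 : ℝ) ≤ (n : ℝ) ^ (1 / 2 : ℝ) := by
    have h144 : (144 : ℝ) ≤ n := by exact_mod_cast hn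
    nlinarith [Real.rpow_nonneg (Nat.cast_nonneg n) (1 / 2 : ℝ)]
  have h : ((6 * ⌈(n : ℝ) ^ (1 / 2 - δ)⌉₊ : ℕ) : ℝ) ≤ (n : ℝ) := by
    push_cast
    nlinarith
  exact_mod_cast h

/-- **Eventually `3200 (L+1)² + 20 ≤ k`**: `log² n = o(n^{1/2-δ})`. [folklore] -/
theorem eventually_kBig {δ : ℝ} (hδ' : δ < 1 / 2) :
    ∀ᶠ n : ℕ in atTop, 3200 * (Nat.log 2 n + 1) ^ 2 + 20 ≤ ⌈(n : ℝ) ^ (1 / 2 - δ)⌉₊ := by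
  have hr : (0 : ℝ) < (1 / 2 - δ) / 2 := by linarith
  -- `|log x| ≤ (log 2 / 160) x^{(1/2-δ)/2}` eventually
  have h1 : ∀ᶠ x : ℝ in atTop, ‖Real.log x‖ ≤ Real.log 2 / 160 * ‖x ^ ((1 / 2 - δ) / 2)‖ :=
    (isLittleO_log_rpow_atTop hr).bound (by positivity)
  have h2 : ∀ᶠ x : ℝ in atTop, (40 : ℝ) ≤ x ^ (1 / 2 - δ) :=
    (tendsto_rpow_atTop (by linarith : (0 : ℝ) < 1 / 2 - δ)).eventually_ge_atTop 40
  have h1' := h1.natCast_atTop  -- along `n : ℕ`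
  have h2' := h2.natCast_atTop
  filter_upwards [h1', h2', eventually_ge_atTop 2] with n hlog h40 hn2
  have hn1 : 1 ≤ n := by omega
  have hnpos : (0 : ℝ) < n := by exact_mod_cast (show 0 < n by omega)
  have hl2 : 0 < Real.log 2 := Real.log_pos one_lt_two
  -- `L + 1 ≤ 2 log₂ n = 2 log n / log 2`
  have hL : ((Nat.log 2 n : ℕ) : ℝ) + 1 ≤ 2 * (Real.log n / Real.log 2) := by
    have h : (Nat.log 2 n : ℝ) ≤ Real.logb 2 n := by   -- `2^L ≤ n`
      rw [Real.le_logb_iff_rpow_le (by norm_num) hnpos, Real.rpow_natCast]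
      exact_mod_cast Nat.pow_log_le_self 2 (by omega)
    have h1 := one_le_logb hn2
    rw [Real.logb] at h h1
    linarith
  have hlog' : Real.log n ≤ Real.log 2 / 160 * (n : ℝ) ^ ((1 / 2 - δ) / 2) := by
    have := hlog
    rwa [Real.norm_of_nonneg (Real.log_nonneg (by exact_mod_cast hn1)),
      Real.norm_of_nonneg (Real.rpow_nonneg hnpos.le _)] at this
  have hsq : ((n : ℝ) ^ ((1 / 2 - δ) / 2)) ^ 2 = (n : ℝ) ^ (1 / 2 - δ) := by
    rw [← Real.rpow_mul_natCast hnpos.le]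
    ring_nf
  -- `(L+1)² ≤ 4 log² n / log² 2 ≤ 4/log²2 · (log 2/160)² · n^{1/2-δ} = n^{1/2-δ} / 6400`
  have hlogn : 0 ≤ Real.log n := Real.log_nonneg (by exact_mod_cast hn1)
  have hLsq : (((Nat.log 2 n : ℕ) : ℝ) + 1) ^ 2 ≤ (n : ℝ) ^ (1 / 2 - δ) / 6400 := by
    have hdiv : Real.log n / Real.log 2 ≤ (n : ℝ) ^ ((1 / 2 - δ) / 2) / 160 := by
      rw [div_le_iff₀ hl2]
      linarith
    have hL0 : 0 ≤ ((Nat.log 2 n : ℕ) : ℝ) + 1 := by positivity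
    calc (((Nat.log 2 n : ℕ) : ℝ) + 1) ^ 2 ≤ (2 * (Real.log n / Real.log 2)) ^ 2 :=
          pow_le_pow_left₀ hL0 hL 2
      _ ≤ (2 * ((n : ℝ) ^ ((1 / 2 - δ) / 2) / 160)) ^ 2 :=
          pow_le_pow_left₀ (by positivity) (by linarith) 2
      _ = (n : ℝ) ^ (1 / 2 - δ) / 6400 := by rw [← hsq]; ring
  have h : ((3200 * (Nat.log 2 n + 1) ^ 2 + 20 : ℕ) : ℝ) ≤ (⌈(n : ℝ) ^ (1 / 2 - δ)⌉₊ : ℝ) := by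
    push_cast
    linarith [rpow_le_k δ n]
  exact_mod_cast h

/-- **Eventually `18 + 2 log₂ (L+1) ≤ ε log₂ n`**: `log log n = o(log n)`. [folklore] -/
theorem eventually_logSlack {ε : ℝ} (hε : 0 < ε) :
    ∀ᶠ n : ℕ in atTop, 18 + 2 * Real.logb 2 ((Nat.log 2 n : ℝ) + 1) ≤ ε * Real.logb 2 n := by
  have hl2 : 0 < Real.log 2 := Real.log_pos one_lt_two
  -- in the variable `m = log₂ n → ∞`: `20 + 2 log₂ m ≤ ε m` eventually
  have hm : ∀ᶠ m : ℝ in atTop, 20 + 2 * Real.logb 2 m ≤ ε * m := by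
    have h1 : ∀ᶠ m : ℝ in atTop, ‖Real.log m‖ ≤ ε * Real.log 2 / 4 * ‖m‖ :=
      Real.isLittleO_log_id_atTop.bound (by positivity)
    filter_upwards [h1, eventually_ge_atTop (max 1 (40 / ε))] with m hlog hm
    have hm1 : 1 ≤ m := le_of_max_le_left hm
    have hm40 : 40 / ε ≤ m := le_of_max_le_right hm
    rw [Real.norm_of_nonneg (Real.log_nonneg hm1), Real.norm_of_nonneg (by linarith)] at hlog
    have h40 : 40 ≤ ε * m := by rwa [div_le_iff₀' hε] at hm40
    have hlogb : Real.logb 2 m ≤ ε / 4 * m := by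
      rw [Real.logb, div_le_iff₀ hl2]
      linarith
    linarith
  have hT : Tendsto (fun n : ℕ => Real.logb 2 (n : ℝ)) atTop atTop :=
    (Real.tendsto_logb_atTop one_lt_two).comp tendsto_natCast_atTop_atTop
  filter_upwards [hT.eventually hm, eventually_ge_atTop 2] with n hn hn2
  have hn1 : 1 ≤ n := by omega
  -- `L + 1 ≤ 2 log₂ n`, so `log₂ (L+1) ≤ 1 + log₂ log₂ n`
  have h1 := one_le_logb hn2
  have hnpos : (0 : ℝ) < n := by exact_mod_cast (show 0 < n by omega)
  have hnat : (Nat.log 2 n : ℝ) ≤ Real.logb 2 n := by   -- `2^L ≤ n`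
    rw [Real.le_logb_iff_rpow_le (by norm_num) hnpos, Real.rpow_natCast]
    exact_mod_cast Nat.pow_log_le_self 2 (by omega)
  have hL : (Nat.log 2 n : ℝ) + 1 ≤ 2 * Real.logb 2 n := by linarith
  have hL0 : (0 : ℝ) < (Nat.log 2 n : ℝ) + 1 := by positivity
  have hlogL : Real.logb 2 ((Nat.log 2 n : ℝ) + 1) ≤ 1 + Real.logb 2 (Real.logb 2 n) := by
    calc Real.logb 2 ((Nat.log 2 n : ℝ) + 1) ≤ Real.logb 2 (2 * Real.logb 2 n) :=
          Real.logb_le_logb_of_le one_lt_two hL0 hL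
      _ = 1 + Real.logb 2 (Real.logb 2 n) := by
          rw [Real.logb_mul (by norm_num) (by linarith), Real.logb_self_eq_one one_lt_two]
  have h' : 20 + 2 * Real.logb 2 (Real.logb 2 (n : ℝ)) ≤ ε * Real.logb 2 (n : ℝ) := hn
  linarith

/-- **The base parameters, eventually.** For `0 < δ < 1/2` and `ε > 0`, all large `n` satisfy:
`2048 ≤ n`, `3200 (L+1)² + 20 ≤ k`, `6k ≤ n`, `k² ≤ 4n`, `n^{1-2δ} ≤ k²` and
`18 + 2 log₂(L+1) ≤ ε log₂ n`, where `k = ⌈n^{1/2-δ}⌉`, `L = ⌊log₂ n⌋`. [folklore] -/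
theorem eventually_base {δ ε : ℝ} (hδ : 0 < δ) (hδ' : δ < 1 / 2) (hε : 0 < ε) :
    ∀ᶠ n : ℕ in atTop, 2048 ≤ n ∧ 3200 * (Nat.log 2 n + 1) ^ 2 + 20 ≤ ⌈(n : ℝ) ^ (1 / 2 - δ)⌉₊ ∧
      6 * ⌈(n : ℝ) ^ (1 / 2 - δ)⌉₊ ≤ n ∧ ⌈(n : ℝ) ^ (1 / 2 - δ)⌉₊ ^ 2 ≤ 4 * n ∧
      (n : ℝ) ^ (1 - 2 * δ) ≤ (⌈(n : ℝ) ^ (1 / 2 - δ)⌉₊ : ℝ) ^ 2 ∧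
      18 + 2 * Real.logb 2 ((Nat.log 2 n : ℝ) + 1) ≤ ε * Real.logb 2 n := by
  filter_upwards [eventually_ge_atTop 2048, eventually_kBig hδ', eventually_sixK hδ,
    eventually_logSlack hε] with n h1 h2 h3 h4
  exact ⟨h1, h2, h3, kSq_le_four_mul hδ (by omega), rpow_le_kSq δ n, h4⟩

end Summit.PneNP.PneNP.Theorems.MonotoneSuffices.Room

namespace Summit.PneNP.PneNP.Theorems.MonotoneSuffices.Room

/-- Registered sub-goal `room_base` of stmt-PneNP-18026 (room theorem, part 4a): the base asymptotics of
`k = ⌈n^{1/2-δ}⌉`, exported verbatim. [folklore] -/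
theorem room_base :
    ∀ {δ ε : ℝ}, 0 < δ → δ < 1 / 2 → 0 < ε → ∀ᶠ n : ℕ in Filter.atTop, 2048 ≤ n ∧ 3200 * (Nat.log 2 n + 1) ^ 2 + 20 ≤ ⌈(n : ℝ) ^ (1 / 2 - δ)⌉₊ ∧ 6 * ⌈(n : ℝ) ^ (1 / 2 - δ)⌉₊ ≤ n ∧ ⌈(n : ℝ) ^ (1 / 2 - δ)⌉₊ ^ 2 ≤ 4 * n ∧ (n : ℝ) ^ (1 - 2 * δ) ≤ (⌈(n : ℝ) ^ (1 / 2 - δ)⌉₊ : ℝ) ^ 2 ∧ 18 + 2 * Real.logb 2 ((Nat.log 2 n : ℝ) + 1) ≤ ε * Real.logb 2 n :=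
  fun hδ hδ' hε => eventually_base hδ hδ' hε

end Summit.PneNP.PneNP.Theorems.MonotoneSuffices.Room
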